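import Summits.CriticalPhenomena.CardyFormulaZ2.Theses.CardyIKTransport
import Literature.Probability.Percolation.QuadCrossingSquareModel
import Literature.Probability.RandomPlanarGeometry.CrossRatioContinuity
import Literature.Probability.RandomPlanarGeometry.ModulusSymmetry
import Literature.Probability.RandomPlanarGeometry.MarkedDomainCorners

/-!
# `RenewalGridHarmless` (stmt-CriticalPhenomena-4967), sandwich step 3: the moduli of the
# bulged templates tend to `η(R)` and to `1 - η(R)`

Route `CardyIKTransport`, support item `RenewalGridHarmless`. The conformal-geometry inputs of the
sandwich, all reduced to theorems of the tree:

* `crossRatio_eq_of_carrier_eq_of_pt_eq` — conformal rectangles with the same carrier and the same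
  four marked points have the same Cardy cross-ratio (conformal invariance of the modulus,
  `crossRatio_eq_of_isUniformizing_holds`, transported across the two structures);
* `crossRatio_eq_one_sub_of_pt_eq_succ` — if `R'` has the carrier of `R` and the marked points of
  `R` shifted by one (`R'.pt i = R.pt (i+1)`, the CONJUGATE marking: `R'.arc 0 = R.arc 1`), then
  `η(R') = 1 - η(R)` (Möbius renormalisation `exists_isUniformizing_of_cyclic` + the cyclic
  cross-ratio identity);
* `tendsto_crossRatio_perturbQuad` — for a plane homeomorphism `Ψ` the moduli of the symmetric
  perturbed quads `Ψ([-1+ε,1-ε] × [-1-ε,1+ε])` tend, as `ε → 0⁺` along any sequence, to the modulus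
  of `Ψ([-1,1]²)` (Radó continuity of the modulus, `tendsto_crossRatio_of_tendstoUniformly`: the
  boundary polygons converge uniformly and so do the corners);
* the identification of `Ψ([-1,1]²)` for `Ψ = Φ` a square model of `R` (same carrier, same marked
  points as `R`) and for `Ψ = Φ ∘ (i ·)` (same carrier, marked points shifted by one).

References: Ch. Pommerenke, *Boundary Behaviour of Conformal Maps* (1992) §2.3 (Radó; the
modulus of a quadrilateral); L. V. Ahlfors, *Complex Analysis* (1979) Ch. 3 §3.1; V. Beffara,
arXiv:0708.3908, proof of Prop. 4 (conjugate marking); the tree files cited above.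
-/

noncomputable section

namespace Summit.CriticalPhenomena.CardyFormulaZ2.Theorems.CardyIKTransport.RenewalGridHarmless

open Filter Set Metric Complex
open scoped Topology
open UpperHalfPlane (upperHalfPlaneSet)
open Literature.Probability.Percolation
open Literature.Probability.LatticeModels
open Literature.Probability.RandomPlanarGeometry

/-! ### Transport of the modulus across equal carriers -/

/-- **Same carrier, same marked points, same modulus.** [folklore] -/
theorem crossRatio_eq_of_carrier_eq_of_pt_eq {R R' : ConformalRectangle}
    (hc : R'.carrier = R.carrier) (hp : ∀ i, R'.pt i = R.pt i)
    {φ : ConformalEquiv upperHalfPlaneSet R.carrier} {x : Fin 4 → ℝ} (hφ : R.IsUniformizing φ x)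
    {φ' : ConformalEquiv upperHalfPlaneSet R'.carrier} {x' : Fin 4 → ℝ}
    (hφ' : R'.IsUniformizing φ' x') : crossRatio x' = crossRatio x := by
  obtain ⟨⟨carrier', bd', h1, h2, h3, h4, h5, h6, h7⟩, mark', hm1, hm2⟩ := R'
  simp only at hc
  subst hc
  have hφ'' : R.IsUniformizing φ' x' := by
    refine ⟨hφ'.1, fun i => ?_⟩
    have := hφ'.2 i
    rwa [hp i] at this
  exact ConformalRectangle.crossRatio_eq_of_isUniformizing_holds hφ'' hφ

/-- The cyclic cross-ratio identity `η(x₃, x₀, x₁, x₂) = 1 - η(x₀, x₁, x₂, x₃)` for four points with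
`x₀ ≠ x₂`, `x₁ ≠ x₃`. Ahlfors (1979), Ch. 3 §3.1. [folklore] -/
theorem crossRatio_rotate_three (x : Fin 4 → ℝ) (h02 : x 0 ≠ x 2) (h13 : x 1 ≠ x 3) :
    crossRatio (fun i => x (i + 3)) = 1 - crossRatio x := by
  have e0 : ((0 : Fin 4) + 3) = 3 := rfl
  have e1 : ((1 : Fin 4) + 3) = 0 := rfl
  have e2 : ((2 : Fin 4) + 3) = 1 := rfl
  have e3 : ((3 : Fin 4) + 3) = 2 := rfl
  have ha : x 0 - x 2 ≠ 0 := sub_ne_zero.2 h02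
  have hb : x 1 - x 3 ≠ 0 := sub_ne_zero.2 h13
  have hc : x 3 - x 1 ≠ 0 := sub_ne_zero.2 (Ne.symm h13)
  unfold crossRatio
  simp only [e0, e1, e2, e3]
  field_simp
  ring

/-- **Conjugate marking has modulus `1 - η`.** If `R'` has the carrier of `R` and marked points
`R'.pt i = R.pt (i + 1)`, then every uniformizing datum of `R'` has cross-ratio `1 - η(R)`: its
uniformizing map has boundary values `R.pt i` at the cyclically rotated tuple `i ↦ x' (i + 3)`,
which a real Möbius map of `ℍₒ` renormalises into a uniformizing datum of `R`
(`exists_isUniformizing_of_cyclic`) with the same cross-ratio `= 1 - crossRatio x'`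
(`crossRatio_rotate_three`). Beffara, arXiv:0708.3908, proof of Prop. 4. [folklore] -/
theorem crossRatio_eq_one_sub_of_pt_eq_succ {R R' : ConformalRectangle}
    (hc : R'.carrier = R.carrier) (hp : ∀ i, R'.pt i = R.pt (i + 1))
    {φ : ConformalEquiv upperHalfPlaneSet R.carrier} {x : Fin 4 → ℝ} (hφ : R.IsUniformizing φ x)
    {φ' : ConformalEquiv upperHalfPlaneSet R'.carrier} {x' : Fin 4 → ℝ}
    (hφ' : R'.IsUniformizing φ' x') : crossRatio x' = 1 - crossRatio x := by
  obtain ⟨⟨carrier', bd', h1, h2, h3, h4, h5, h6, h7⟩, mark', hm1, hm2⟩ := R'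
  simp only at hc
  subst hc
  -- boundary values of `φ'` at the rotated tuple
  set y : Fin 4 → ℝ := fun i => x' (i + 3) with hy
  have hbv : ∀ i, φ'.HasBoundaryValue (y i) (R.pt i) := by
    intro i
    have := hφ'.2 (i + 3)
    rw [hp] at this
    have e : i + 3 + 1 = i := by
      rw [add_assoc]; exact add_eq_left.2 rfl
    rwa [e] at this
  have hinj : Function.Injective x' := hφ'.1.elim StrictMono.injective StrictAnti.injective
  have hpat : (y 1 < y 2 ∧ y 2 < y 3 ∧ y 3 < y 0) ∨ (y 0 < y 3 ∧ y 3 < y 2 ∧ y 2 < y 1) := by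
    have e0 : y 0 = x' 3 := rfl
    have e1 : y 1 = x' 0 := rfl
    have e2 : y 2 = x' 1 := rfl
    have e3 : y 3 = x' 2 := rfl
    rw [e0, e1, e2, e3]
    rcases hφ'.1 with hm | hm
    · exact Or.inl ⟨hm (by decide), hm (by decide), hm (by decide)⟩
    · exact Or.inr ⟨hm (by decide), hm (by decide), hm (by decide)⟩
  obtain ⟨φ'', x'', hφ'', hcr⟩ := ConformalRectangle.exists_isUniformizing_of_cyclic R φ' y hbv hpat
  have h1 : crossRatio x'' = crossRatio x :=
    ConformalRectangle.crossRatio_eq_of_isUniformizing_holds hφ'' hφ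
  have h2 : crossRatio y = 1 - crossRatio x' :=
    crossRatio_rotate_three x' (hinj.ne (by decide)) (hinj.ne (by decide))
  linarith


/-! ### Uniform control of the rectangle boundary polygons -/

/-- Knot uniqueness: `k + θ = k' + θ'` with `θ, θ' ∈ [0,1)` forces `k = k'`, `θ = θ'`. [folklore] -/
theorem nat_eq_of_add_eq {k k' : ℕ} {θ θ' : ℝ} (hθ : θ ∈ Ico (0 : ℝ) 1) (hθ' : θ' ∈ Ico (0 : ℝ) 1)
    (h : (k : ℝ) + θ = k' + θ') : k = k' ∧ θ = θ' := by
  have h1 : (k : ℝ) < k' + 1 := by linarith [hθ.1, hθ'.2]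
  have h2 : (k' : ℝ) < k + 1 := by linarith [hθ'.1, hθ.2]
  have h1' : k < k' + 1 := by exact_mod_cast h1
  have h2' : k' < k + 1 := by exact_mod_cast h2
  have hk : k = k' := by omega
  subst hk
  exact ⟨rfl, by linarith⟩

/-- The corners of two symmetric rectangles differ by at most `|w - w'| + |h - h'|`. [folklore] -/
theorem norm_rectVerts_sub_le (w h w' h' : ℝ) {k : ℕ} (hk : k < 4) :
    ‖(rectVerts w h)[k]'(by simp; omega) - (rectVerts w' h')[k]'(by simp; omega)‖ ≤
      |w - w'| + |h - h'| := by
  interval_cases k <;>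
  · refine (Complex.norm_le_abs_re_add_abs_im _).trans ?_
    simp only [rectVerts, List.getElem_cons_zero, List.getElem_cons_succ, Complex.sub_re,
      Complex.sub_im]
    refine add_le_add ?_ ?_ <;>
      first
      | exact le_of_eq rfl
      | (rw [show -w - -w' = -(w - w') by ring, abs_neg])
      | (rw [show -h - -h' = -(h - h') by ring, abs_neg])

/-- Convex combinations with the same weight of `M`-close points are `M`-close. [folklore] -/
theorem norm_convexComb_sub_le {a a' b b' : ℂ} {M θ : ℝ} (hθ : θ ∈ Ico (0 : ℝ) 1)
    (ha : ‖a - a'‖ ≤ M) (hb : ‖b - b'‖ ≤ M) :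
    ‖(1 - θ) • a + θ • b - ((1 - θ) • a' + θ • b')‖ ≤ M := by
  have e : (1 - θ) • a + θ • b - ((1 - θ) • a' + θ • b') =
      (1 - θ) • (a - a') + θ • (b - b') := by
    simp only [smul_sub]; abel
  rw [e]
  calc ‖(1 - θ) • (a - a') + θ • (b - b')‖ ≤ ‖(1 - θ) • (a - a')‖ + ‖θ • (b - b')‖ :=
        norm_add_le _ _
    _ ≤ (1 - θ) * M + θ * M := by
        rw [norm_smul, norm_smul, Real.norm_eq_abs, Real.norm_eq_abs, abs_of_nonneg hθ.1,
          abs_of_nonneg (by linarith [hθ.2])]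
        exact add_le_add (mul_le_mul_of_nonneg_left ha (by linarith [hθ.2]))
          (mul_le_mul_of_nonneg_left hb hθ.1)
    _ = M := by ring

/-- **The boundary polygons of symmetric rectangles are uniformly close**:
`‖∂[-w,w]×[-h,h] (t) - ∂[-w',w']×[-h',h'] (t)‖ ≤ |w - w'| + |h - h'|` at every time `t` (both
loops run on the same edge with the same affine parameter). [folklore] -/
theorem norm_polygonLoop_rectVerts_sub_le (w h w' h' t : ℝ) :
    ‖polygonLoop (rectVerts w h) t - polygonLoop (rectVerts w' h') t‖ ≤ |w - w'| + |h - h'| := by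
  obtain ⟨k, hk, θ, hθ, hkt, hval⟩ :=
    polygonLoop_eq_of_floor (l := rectVerts w h) (by simp [rectVerts]) t
  obtain ⟨k', hk', θ', hθ', hkt', hval'⟩ :=
    polygonLoop_eq_of_floor (l := rectVerts w' h') (by simp [rectVerts]) t
  simp only [length_rectVerts] at hk hk' hkt hkt' hval hval'
  have hkk : (k : ℝ) + θ = k' + θ' := by
    have := hkt.trans hkt'.symm
    field_simp at this
    linarith
  obtain ⟨rfl, rfl⟩ := nat_eq_of_add_eq hθ hθ' hkk
  rw [hval, hval', AffineMap.lineMap_apply_module, AffineMap.lineMap_apply_module]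
  exact norm_convexComb_sub_le hθ (norm_rectVerts_sub_le w h w' h' hk)
    (norm_rectVerts_sub_le w h w' h' (k := (k + 1) % 4) (Nat.mod_lt _ (by norm_num)))

/-- A convex combination of points of norm `≤ M` has norm `≤ M`. [folklore] -/
theorem norm_convexComb_le {a b : ℂ} {M θ : ℝ} (hθ : θ ∈ Ico (0 : ℝ) 1)
    (ha : ‖a‖ ≤ M) (hb : ‖b‖ ≤ M) : ‖(1 - θ) • a + θ • b‖ ≤ M := by
  calc ‖(1 - θ) • a + θ • b‖ ≤ ‖(1 - θ) • a‖ + ‖θ • b‖ := norm_add_le _ _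
    _ ≤ (1 - θ) * M + θ * M := by
        rw [norm_smul, norm_smul, Real.norm_eq_abs, Real.norm_eq_abs, abs_of_nonneg hθ.1,
          abs_of_nonneg (by linarith [hθ.2])]
        exact add_le_add (mul_le_mul_of_nonneg_left ha (by linarith [hθ.2]))
          (mul_le_mul_of_nonneg_left hb hθ.1)
    _ = M := by ring

/-- The corners of the symmetric rectangle are within `|w| + |h|` of the origin. [folklore] -/
theorem norm_rectVerts_le (w h : ℝ) {k : ℕ} (hk : k < 4) :
    ‖(rectVerts w h)[k]'(by simp; omega)‖ ≤ |w| + |h| := by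
  interval_cases k <;>
  · refine (Complex.norm_le_abs_re_add_abs_im _).trans ?_
    simp [rectVerts, abs_neg]

/-- The boundary polygon of `[-w,w] × [-h,h]` stays within `|w| + |h|` of the origin. [folklore] -/
theorem norm_polygonLoop_rectVerts_le (w h t : ℝ) : ‖polygonLoop (rectVerts w h) t‖ ≤ |w| + |h| := by
  obtain ⟨k, hk, θ, hθ, -, hval⟩ :=
    polygonLoop_eq_of_floor (l := rectVerts w h) (by simp [rectVerts]) t
  simp only [length_rectVerts] at hk hval
  rw [hval, AffineMap.lineMap_apply_module]
  exact norm_convexComb_le hθ (norm_rectVerts_le w h hk)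
    (norm_rectVerts_le w h (k := (k + 1) % 4) (Nat.mod_lt _ (by norm_num)))

/-! ### Radó continuity for the perturbed-quad families -/

/-- The boundary loop of a perturbed quad, unfolded: `Ψ (polygon of the centred rectangle + centre)`.
[folklore] -/
theorem perturbQuad_boundary (Ψ : ℂ ≃ₜ ℂ) {x₀ x₁ y₀ y₁ : ℝ} (hx : x₀ < x₁) (hy : y₀ < y₁) (t : ℝ) :
    (perturbQuad Ψ x₀ x₁ y₀ y₁ hx hy).boundary t =
      Ψ (polygonLoop (rectVerts ((x₁ - x₀) / 2) ((y₁ - y₀) / 2)) t +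
        ⟨(x₀ + x₁) / 2, (y₀ + y₁) / 2⟩) := rfl

/-- The marks of a perturbed quad are the quarter marks. [folklore] -/
theorem perturbQuad_pt (Ψ : ℂ ≃ₜ ℂ) {x₀ x₁ y₀ y₁ : ℝ} (hx : x₀ < x₁) (hy : y₀ < y₁) (i : Fin 4) :
    (perturbQuad Ψ x₀ x₁ y₀ y₁ hx hy).pt i =
      (perturbQuad Ψ x₀ x₁ y₀ y₁ hx hy).boundary (quarterMarks i) := rfl

/-- **Radó continuity of the modulus along perturbed quads.** For a plane homeomorphism `Ψ` and
parameters `x₀ n → -1`, `x₁ n → 1`, `y₀ n → -1`, `y₁ n → 1`, the Cardy cross-ratio of ANY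
uniformizing data of `Ψ([x₀ n, x₁ n] × [y₀ n, y₁ n])` tends to that of any uniformizing datum of
`Ψ([-1,1]²)`: the boundary polygons converge uniformly (`norm_polygonLoop_rectVerts_sub_le` and
uniform continuity of `Ψ` on a compact set), hence so do the marked points, and
`ConformalRectangle.tendsto_crossRatio_of_tendstoUniformly` (Radó's theorem, proved in the tree)
applies. [folklore] -/
theorem tendsto_crossRatio_perturbQuad (Ψ : ℂ ≃ₜ ℂ) {x₀ x₁ y₀ y₁ : ℕ → ℝ}
    (hx : ∀ n, x₀ n < x₁ n) (hy : ∀ n, y₀ n < y₁ n)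
    (h₀ : Tendsto x₀ atTop (𝓝 (-1))) (h₁ : Tendsto x₁ atTop (𝓝 1))
    (h₂ : Tendsto y₀ atTop (𝓝 (-1))) (h₃ : Tendsto y₁ atTop (𝓝 1))
    (ψ : ∀ n, ConformalEquiv upperHalfPlaneSet
      (perturbQuad Ψ (x₀ n) (x₁ n) (y₀ n) (y₁ n) (hx n) (hy n)).carrier) (y : ℕ → Fin 4 → ℝ)
    (hψ : ∀ n, (perturbQuad Ψ (x₀ n) (x₁ n) (y₀ n) (y₁ n) (hx n) (hy n)).IsUniformizing (ψ n) (y n))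
    (φ : ConformalEquiv upperHalfPlaneSet
      (perturbQuad Ψ (-1) 1 (-1) 1 (by norm_num) (by norm_num)).carrier) (x : Fin 4 → ℝ)
    (hφ : (perturbQuad Ψ (-1) 1 (-1) 1 (by norm_num) (by norm_num)).IsUniformizing φ x) :
    Tendsto (fun n ↦ crossRatio (y n)) atTop (𝓝 (crossRatio x)) := by
  -- uniform convergence of the boundary loops
  have hJ : TendstoUniformly
      (fun n ↦ (perturbQuad Ψ (x₀ n) (x₁ n) (y₀ n) (y₁ n) (hx n) (hy n)).boundary)
      (perturbQuad Ψ (-1) 1 (-1) 1 (by norm_num) (by norm_num)).boundary atTop := by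
    rw [Metric.tendstoUniformly_iff]
    intro κ hκ
    -- uniform continuity of `Ψ` on a big closed ball
    have hK : IsCompact (closedBall (0 : ℂ) 10) := isCompact_closedBall 0 10
    obtain ⟨η, hη, hΨ⟩ := Metric.uniformContinuousOn_iff.1
      (hK.uniformContinuousOn_of_continuous Ψ.continuous.continuousOn) κ hκ
    -- the parameters are eventually close to `(-1, 1, -1, 1)`
    have hη8 : 0 < η / 8 := by positivity
    have e₀ := h₀.eventually (Metric.ball_mem_nhds (-1 : ℝ) hη8)
    have e₁ := h₁.eventually (Metric.ball_mem_nhds (1 : ℝ) hη8)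
    have e₂ := h₂.eventually (Metric.ball_mem_nhds (-1 : ℝ) hη8)
    have e₃ := h₃.eventually (Metric.ball_mem_nhds (1 : ℝ) hη8)
    have b₀ := h₀.eventually (Metric.ball_mem_nhds (-1 : ℝ) one_pos)
    have b₁ := h₁.eventually (Metric.ball_mem_nhds (1 : ℝ) one_pos)
    have b₂ := h₂.eventually (Metric.ball_mem_nhds (-1 : ℝ) one_pos)
    have b₃ := h₃.eventually (Metric.ball_mem_nhds (1 : ℝ) one_pos)
    filter_upwards [e₀, e₁, e₂, e₃, b₀, b₁, b₂, b₃] with n hn₀ hn₁ hn₂ hn₃ hb₀ hb₁ hb₂ hb₃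
    intro t
    rw [Real.dist_eq] at hn₀ hn₁ hn₂ hn₃ hb₀ hb₁ hb₂ hb₃
    rw [perturbQuad_boundary, perturbQuad_boundary, dist_comm]
    set L : ℂ := polygonLoop (rectVerts ((x₁ n - x₀ n) / 2) ((y₁ n - y₀ n) / 2)) t +
      ⟨(x₀ n + x₁ n) / 2, (y₀ n + y₁ n) / 2⟩ with hL
    set L₀ : ℂ := polygonLoop (rectVerts ((1 - -1) / 2) ((1 - -1) / 2)) t +
      ⟨(-1 + 1) / 2, (-1 + 1) / 2⟩ with hL₀
    refine hΨ L ?_ L₀ ?_ ?_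
    · rw [mem_closedBall, dist_zero_right, hL]
      refine (norm_add_le _ _).trans ?_
      have h1 := norm_polygonLoop_rectVerts_le ((x₁ n - x₀ n) / 2) ((y₁ n - y₀ n) / 2) t
      have h2 : ‖(⟨(x₀ n + x₁ n) / 2, (y₀ n + y₁ n) / 2⟩ : ℂ)‖ ≤
          |(x₀ n + x₁ n) / 2| + |(y₀ n + y₁ n) / 2| := Complex.norm_le_abs_re_add_abs_im _
      have : |(x₁ n - x₀ n) / 2| + |(y₁ n - y₀ n) / 2| + (|(x₀ n + x₁ n) / 2| + |(y₀ n + y₁ n) / 2|)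
          ≤ 10 := by
        obtain ⟨c0, d0⟩ := abs_lt.1 hb₀
        obtain ⟨c1, d1⟩ := abs_lt.1 hb₁
        obtain ⟨c2, d2⟩ := abs_lt.1 hb₂
        obtain ⟨c3, d3⟩ := abs_lt.1 hb₃
        have t1 : |(x₁ n - x₀ n) / 2| ≤ 2 := abs_le.2 ⟨by linarith, by linarith⟩
        have t2 : |(y₁ n - y₀ n) / 2| ≤ 2 := abs_le.2 ⟨by linarith, by linarith⟩
        have t3 : |(x₀ n + x₁ n) / 2| ≤ 2 := abs_le.2 ⟨by linarith, by linarith⟩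
        have t4 : |(y₀ n + y₁ n) / 2| ≤ 2 := abs_le.2 ⟨by linarith, by linarith⟩
        linarith
      linarith
    · rw [mem_closedBall, dist_zero_right, hL₀]
      have hc : (⟨(-1 + 1) / 2, (-1 + 1) / 2⟩ : ℂ) = 0 := Complex.ext (by simp) (by simp)
      rw [hc, add_zero]
      refine (norm_polygonLoop_rectVerts_le _ _ t).trans ?_
      norm_num
    · rw [hL, hL₀]
      calc dist (polygonLoop (rectVerts ((x₁ n - x₀ n) / 2) ((y₁ n - y₀ n) / 2)) t +
              ⟨(x₀ n + x₁ n) / 2, (y₀ n + y₁ n) / 2⟩)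
            (polygonLoop (rectVerts ((1 - -1) / 2) ((1 - -1) / 2)) t + ⟨(-1 + 1) / 2, (-1 + 1) / 2⟩)
          ≤ ‖polygonLoop (rectVerts ((x₁ n - x₀ n) / 2) ((y₁ n - y₀ n) / 2)) t -
              polygonLoop (rectVerts ((1 - -1) / 2) ((1 - -1) / 2)) t‖ +
            ‖(⟨(x₀ n + x₁ n) / 2, (y₀ n + y₁ n) / 2⟩ : ℂ) - ⟨(-1 + 1) / 2, (-1 + 1) / 2⟩‖ := by
            rw [dist_eq_norm]
            have e : ∀ a b c d : ℂ, a + b - (c + d) = (a - c) + (b - d) := by intros; ring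
            rw [e]; exact norm_add_le _ _
        _ ≤ (|(x₁ n - x₀ n) / 2 - (1 - -1) / 2| + |(y₁ n - y₀ n) / 2 - (1 - -1) / 2|) +
            (|(x₀ n + x₁ n) / 2 - (-1 + 1) / 2| + |(y₀ n + y₁ n) / 2 - (-1 + 1) / 2|) := by
            refine add_le_add (norm_polygonLoop_rectVerts_sub_le _ _ _ _ t) ?_
            refine (Complex.norm_le_abs_re_add_abs_im _).trans ?_
            simp only [Complex.sub_re, Complex.sub_im]; rfl
        _ < η := by
            have a1 : |(x₁ n - x₀ n) / 2 - (1 - -1) / 2| ≤ (|x₁ n - 1| + |x₀ n - -1|) / 2 := by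
              rw [show (x₁ n - x₀ n) / 2 - (1 - -1) / 2 = ((x₁ n - 1) - (x₀ n - -1)) / 2 by ring,
                abs_div, abs_two]
              exact div_le_div_of_nonneg_right (abs_sub _ _) two_pos.le
            have a2 : |(y₁ n - y₀ n) / 2 - (1 - -1) / 2| ≤ (|y₁ n - 1| + |y₀ n - -1|) / 2 := by
              rw [show (y₁ n - y₀ n) / 2 - (1 - -1) / 2 = ((y₁ n - 1) - (y₀ n - -1)) / 2 by ring,
                abs_div, abs_two]
              exact div_le_div_of_nonneg_right (abs_sub _ _) two_pos.le
            have a3 : |(x₀ n + x₁ n) / 2 - (-1 + 1) / 2| ≤ (|x₀ n - -1| + |x₁ n - 1|) / 2 := by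
              rw [show (x₀ n + x₁ n) / 2 - (-1 + 1) / 2 = ((x₀ n - -1) + (x₁ n - 1)) / 2 by ring,
                abs_div, abs_two]
              exact div_le_div_of_nonneg_right (abs_add_le _ _) two_pos.le
            have a4 : |(y₀ n + y₁ n) / 2 - (-1 + 1) / 2| ≤ (|y₀ n - -1| + |y₁ n - 1|) / 2 := by
              rw [show (y₀ n + y₁ n) / 2 - (-1 + 1) / 2 = ((y₀ n - -1) + (y₁ n - 1)) / 2 by ring,
                abs_div, abs_two]
              exact div_le_div_of_nonneg_right (abs_add_le _ _) two_pos.le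
            linarith
  -- convergence of the marked points (same marks for all quads)
  have hpt : ∀ i, Tendsto (fun n ↦ (perturbQuad Ψ (x₀ n) (x₁ n) (y₀ n) (y₁ n) (hx n) (hy n)).pt i)
      atTop (𝓝 ((perturbQuad Ψ (-1) 1 (-1) 1 (by norm_num) (by norm_num)).pt i)) := by
    intro i
    simp only [perturbQuad_pt]
    exact hJ.tendsto_at (quarterMarks i)
  exact ConformalRectangle.tendsto_crossRatio_of_tendstoUniformly
    (Q := fun n ↦ perturbQuad Ψ (x₀ n) (x₁ n) (y₀ n) (y₁ n) (hx n) (hy n)) hJ hpt ψ y hψ φ x hφ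

end Summit.CriticalPhenomena.CardyFormulaZ2.Theorems.CardyIKTransport.RenewalGridHarmless

end
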